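import Summits.Ventures.PercRepro.ProfilePointedCircuitClassesStarNineSplitC

/-!
# PercRepro — THE TWO-PART SPLIT OF THE DEFECT BOUND, PART D: (★)₉ WHEN `e` IS ON NO `3`-CIRCUIT AND NO KILL EXISTS
(p5, gen 58; `proofs/P5-GM1.md` §86 ADD 1)

THE FIRST-KIND BOUND BY A SECOND DOUBLE COUNT.  Over the relation `π ⊆ τ` between the first-kind `e`-defects `τ`
(`e ∈ cl K`, `K := X − τ`) and the `C`-pairs `π`: (i) every first-kind `τ` has `≥ 2` pairs `π = τ − z` with `z ∉ cl K`
(the hyperplane `cl K ⊇ K + e` has `≤ 6` points, so `≤ 1` point of `τ` lies in it), and such a `π` is a `C`-pair as soon as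
`f ∉ cl(π + e)` — the NO-KILL hypothesis `hnk` (`f ∉ cl(A + e)` for every `2`-set `A ⊆ X` with `A + e` independent; a
KILL is a `C`-pair candidate with `π + e + f` dependent: a circuit of size `≤ 4` through `f` inside `X + e + f`);
(ii) every `C`-pair `π` lies in `≤ 2` first-kind defects `π + z`, because `z` must satisfy `e ∈ cl(B₀ − z)` for the basis
`B₀ := X − π`, and three such `z` would put `e` in the closure of the two remaining points of `B₀` — excluded when `e`
lies on no `3`-circuit (`he3`: `e ∉ cl A` for every `2`-set `A ⊆ E − e`).  Hence **`#tTwo ≤ #cPairs`**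
(`card_tTwo_le_card_cPairs_of_noKill`) and, with part B, **`inCount_le_of_noKill`: (★)₉ at `(e, f)`**.  This regime
contains the tight instances of the census (the rank-4 spike with `f` its tip) and 92 % of the core instances; together
with regime E of part C it leaves the instances with a kill or a `3`-circuit through `e` AND a small circuit through `e`.
-/

open scoped Matroid

namespace PercRepro.Cogirth

open Finset ThmH Skew Shadow Profile

open Classical

variable {α : Type} [DecidableEq α] {N : Matroid α} [N.Finite]

section StarNineSplitD

/-- `X − (τ − z) = (X − τ) + z` for `τ ⊆ X`, `z ∈ τ`. -/
theorem X_sdiff_erase_eq_insert_sdiff {X τ : Finset α} (hτX : τ ⊆ X) {z : α} (hz : z ∈ τ) :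
    X \ τ.erase z = insert z (X \ τ) := by
  ext a
  simp only [mem_sdiff, mem_erase, mem_insert, not_and]
  constructor
  · rintro ⟨haX, h⟩
    by_cases haz : a = z
    · exact Or.inl haz
    · exact Or.inr ⟨haX, fun haτ => h haz haτ⟩
  · rintro (rfl | ⟨haX, haτ⟩)
    · exact ⟨hτX hz, fun h _ => absurd rfl h⟩
    · exact ⟨haX, fun _ h => haτ h⟩

/-- **THREE POINTS OF A BASIS CANNOT ALL SPAN `e`** unless `e` lies in the closure of two points: for an independent
`5`-set `B₀` (`e ∉ B₀`) and `e` on no `3`-circuit, at most two `z ∈ B₀` have `e ∈ cl(B₀ − z)`. -/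
theorem card_filter_mem_clF_erase_le_two_of_five {e : α} (he : e ∈ gr N)
    (he3 : ∀ A ⊆ gr N, e ∉ A → A.card = 2 → e ∉ clF N A) {B₀ : Finset α} (hB : B₀ ⊆ gr N) (heB : e ∉ B₀)
    (hcard : B₀.card = 5) (hrk : rk N B₀ = 5) :
    (B₀.filter (fun z => rk N (insert e (B₀.erase z)) ≤ 4)).card ≤ 2 := by
  by_contra hcon
  rw [not_le, two_lt_card_iff] at hcon
  obtain ⟨z₁, z₂, z₃, h₁, h₂, h₃, h12, h13, h23⟩ := hcon
  rw [mem_filter] at h₁ h₂ h₃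
  obtain ⟨hz₁, hr₁⟩ := h₁
  obtain ⟨hz₂, hr₂⟩ := h₂
  obtain ⟨hz₃, hr₃⟩ := h₃
  -- step 1: `ρ(e + (B₀ − z₁ − z₂)) ≤ 3`
  have hsub1 : B₀ ⊆ insert e (B₀.erase z₁) ∪ insert e (B₀.erase z₂) := by
    intro a ha
    rw [mem_union, mem_insert, mem_insert, mem_erase, mem_erase]
    by_cases haz : a = z₁
    · exact Or.inr (Or.inr ⟨haz ▸ h12, ha⟩)
    · exact Or.inl (Or.inr ⟨haz, ha⟩)
  have hI1 : insert e ((B₀.erase z₁).erase z₂) ⊆ insert e (B₀.erase z₁) ∩ insert e (B₀.erase z₂) := by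
    apply subset_inter
    · exact insert_subset_insert e (erase_subset _ _)
    · exact insert_subset_insert e (by rw [erase_right_comm]; exact erase_subset _ _)
  have hs1 := rk_union_add_rk_le_of_subset_inter (N := N) hI1
  have hu1 : 5 ≤ rk N (insert e (B₀.erase z₁) ∪ insert e (B₀.erase z₂)) := hrk ▸ rk_mono' (M := N) hsub1
  have hr12 : rk N (insert e ((B₀.erase z₁).erase z₂)) ≤ 3 := by omega
  -- step 2: with `z₃`, `ρ(e + (B₀ − z₁ − z₂ − z₃)) ≤ 2`
  have hsub2 : B₀ ⊆ insert e (B₀.erase z₃) ∪ insert e ((B₀.erase z₁).erase z₂) := by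
    intro a ha
    rw [mem_union, mem_insert, mem_insert, mem_erase, mem_erase, mem_erase]
    by_cases haz : a = z₃
    · exact Or.inr (Or.inr ⟨haz ▸ h23.symm, haz ▸ h13.symm, ha⟩)
    · exact Or.inl (Or.inr ⟨haz, ha⟩)
  have hI2 : insert e (((B₀.erase z₁).erase z₂).erase z₃) ⊆
      insert e (B₀.erase z₃) ∩ insert e ((B₀.erase z₁).erase z₂) := by
    apply subset_inter
    · exact insert_subset_insert e (fun a ha => mem_erase.2 ⟨(mem_erase.1 ha).1,
        mem_of_mem_erase (mem_of_mem_erase (mem_erase.1 ha).2)⟩)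
    · exact insert_subset_insert e (erase_subset _ _)
  have hs2 := rk_union_add_rk_le_of_subset_inter (N := N) hI2
  have hu2 : 5 ≤ rk N (insert e (B₀.erase z₃) ∪ insert e ((B₀.erase z₁).erase z₂)) :=
    hrk ▸ rk_mono' (M := N) hsub2
  have hr123 : rk N (insert e (((B₀.erase z₁).erase z₂).erase z₃)) ≤ 2 := by omega
  -- the remaining two points `T` are independent of rank `2`, so `e ∈ cl T`
  set T := ((B₀.erase z₁).erase z₂).erase z₃ with hT
  have hTB : T ⊆ B₀ := (erase_subset _ _).trans ((erase_subset _ _).trans (erase_subset _ _))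
  have hTcard : T.card = 2 := by
    rw [hT, card_erase_of_mem (mem_erase.2 ⟨h23.symm, mem_erase.2 ⟨h13.symm, hz₃⟩⟩),
      card_erase_of_mem (mem_erase.2 ⟨h12.symm, hz₂⟩), card_erase_of_mem hz₁, hcard]
  have hTrk : rk N T = 2 := by
    have := rk_eq_card_of_subset_of_rk_eq_card (M := N) hTB (by rw [hrk, hcard])
    rw [this, hTcard]
  have heT : e ∉ T := fun h => heB (hTB h)
  have hcl : e ∈ clF N T := by
    rw [mem_clF_iff_rk_insert he (hTB.trans hB)]
    have := rk_mono' (M := N) (subset_insert e T)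
    omega
  exact he3 T (hTB.trans hB) heT hTcard hcl

/-- **A FIRST-KIND DEFECT `τ` HAS AT LEAST TWO `C`-PAIRS INSIDE IT** when no kill exists: the pairs `τ − z` for the
`≥ 2` points `z ∈ τ` outside the hyperplane `cl(X − τ)`. -/
theorem two_le_card_cPairs_subset_of_noKill (hn : (gr N).card = 9)
    (hcos : ∀ x ∈ gr N, ∀ y ∈ gr N, x ≠ y → rk N (((gr N).erase x).erase y) = 5) {e f : α} (he : e ∈ gr N)
    (hf : f ∈ gr N) (hef : e ≠ f)
    (hnk : ∀ A ⊆ ((gr N).erase e).erase f, A.card = 2 → rk N (insert e A) = 3 → f ∉ clF N (insert e A))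
    {τ : Finset α} (hτ : τ ∈ tTwo N e f) : 2 ≤ ((cPairs N e f).filter (fun π => π ⊆ τ)).card := by
  have hrK := rk_insert_e_sdiff_of_tTwo hn he hf hef hτ
  have hτ' := hτ
  unfold tTwo at hτ'
  rw [mem_filter] at hτ'
  obtain ⟨hτD, _⟩ := hτ'
  obtain ⟨hτX, hτ3, hrkτe, _, hrkK, hK, _⟩ := edefect_facts hn he hf hef hτD
  have hX7 := card_X hn he hf hef
  set X := ((gr N).erase e).erase f with hXdef
  set K := X \ τ with hKdef
  have hXg : X ⊆ gr N := X_subset_gr N e f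
  have hτg : τ ⊆ gr N := hτX.trans hXg
  have hKg : K ⊆ gr N := sdiff_subset.trans hXg
  have heτ : e ∉ τ := fun h => (mem_erase.1 (mem_erase.1 (hτX h)).2).1 rfl
  have hfτ : f ∉ τ := fun h => (mem_erase.1 (hτX h)).1 rfl
  have heK : e ∉ K := fun h => (mem_erase.1 (mem_erase.1 (mem_sdiff.1 h).1).2).1 rfl
  -- the hyperplane `H = cl K` contains `K + e` and has `≤ 6` points
  set H := clF N K with hHdef
  have hHg : H ⊆ gr N := clF_subset_gr _
  have hH6 : H.card ≤ 6 := card_le_six_of_rk_le_four hn hcos hHg (by rw [rk_clF_eq_rk, hrkK])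
  have heH : e ∈ H := by
    rw [hHdef, mem_clF_iff_rk_insert he hKg, hrK, hrkK]
  have hKeH : insert e K ⊆ H := insert_subset heH (subset_clF hKg)
  have hcard5 : (insert e K).card = 5 := by rw [card_insert_of_notMem heK, hK]
  have hτH : τ ∩ H ⊆ H \ insert e K := by
    intro a ha
    rw [mem_inter] at ha
    rw [mem_sdiff, mem_insert, not_or]
    exact ⟨ha.2, fun h => heτ (h ▸ ha.1), fun h => (mem_sdiff.1 h).2 ha.1⟩
  have hτH1 : (τ ∩ H).card ≤ 1 := by
    have := card_le_card hτH
    rw [card_sdiff_of_subset hKeH, hcard5] at this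
    omega
  have hZ : 2 ≤ (τ \ H).card := by
    have := card_sdiff_add_card_inter τ H
    omega
  refine le_trans hZ (card_le_card_of_injOn (fun z => τ.erase z) ?_ ?_)
  · intro z hz
    rw [mem_coe, mem_sdiff] at hz
    rw [mem_coe, mem_filter]
    refine ⟨?_, erase_subset z τ⟩
    have hzg : z ∈ gr N := hτg hz.1
    have hπX : τ.erase z ⊆ X := (erase_subset _ _).trans hτX
    have hπ2 : (τ.erase z).card = 2 := by rw [card_erase_of_mem hz.1, hτ3]
    have heπ : e ∉ τ.erase z := fun h => heτ (mem_of_mem_erase h)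
    have hfπ : f ∉ τ.erase z := fun h => hfτ (mem_of_mem_erase h)
    have hefπ : e ∉ insert f (τ.erase z) := by rw [mem_insert, not_or]; exact ⟨hef, heπ⟩
    -- `π + e` is independent of rank `3`
    have hrkπe : rk N (insert e (τ.erase z)) = 3 := by
      have := rk_eq_card_of_subset_of_rk_eq_card (M := N)
        (insert_subset_insert e (erase_subset z τ) : insert e (τ.erase z) ⊆ insert e τ)
        (by rw [hrkτe, card_insert_of_notMem heτ, hτ3])
      rw [this, card_insert_of_notMem heπ, hπ2]
    -- no kill: `f ∉ cl(π + e)`, so `π + e + f` has rank `4`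
    have hfcl := hnk (τ.erase z) hπX hπ2 hrkπe
    have hrkπef : rk N (insert e (insert f (τ.erase z))) = 4 := by
      rw [Finset.insert_comm, rk_insert_of_notMem_clF' hf (insert_subset he (hπX.trans hXg)) hfcl, hrkπe]
    -- the complement `K + z` is a basis
    have hcompl : rk N (insert z K) = 5 := by
      rw [rk_insert_of_notMem_clF' hzg hKg hz.2, hrkK]
    unfold cPairs
    rw [mem_filter, mem_powersetCard, mem_biIndepSets]
    refine ⟨⟨hπX, hπ2⟩, insert_subset he (insert_subset hf (hπX.trans hXg)), ?_, ?_, ?_⟩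
    · rw [card_insert_of_notMem hefπ, card_insert_of_notMem hfπ, hπ2]
    · rw [hrkπef, card_insert_of_notMem hefπ, card_insert_of_notMem hfπ, hπ2]
    · have hzK : z ∉ K := fun h => (mem_sdiff.1 h).2 hz.1
      rw [gr_sdiff_insert_ef_of_subset_X hπX, X_sdiff_erase_eq_insert_sdiff hτX hz.1, hcompl,
        card_insert_of_notMem hzK, hK]
  · intro z₁ hz₁ z₂ hz₂ h
    rw [mem_coe, mem_sdiff] at hz₁ hz₂
    exact (erase_inj τ hz₁.1).1 h

/-- **A `C`-PAIR LIES IN AT MOST TWO FIRST-KIND DEFECTS** when `e` is on no `3`-circuit: a defect `π + z` needs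
`e ∈ cl(B₀ − z)` for the basis `B₀ := X − π`. -/
theorem card_tTwo_supset_le_two_of_three_circuit_free (hn : (gr N).card = 9) {e f : α} (he : e ∈ gr N)
    (hf : f ∈ gr N) (hef : e ≠ f) (he3 : ∀ A ⊆ gr N, e ∉ A → A.card = 2 → e ∉ clF N A) {π : Finset α}
    (hπ : π ∈ cPairs N e f) : ((tTwo N e f).filter (fun τ => π ⊆ τ)).card ≤ 2 := by
  have hπ' := hπ
  unfold cPairs at hπ'
  rw [mem_filter, mem_powersetCard] at hπ'
  obtain ⟨⟨hπX, hπ2⟩, hπbi⟩ := hπ'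
  obtain ⟨_, _, _, hπcompl⟩ := mem_biIndepSets.1 hπbi
  rw [gr_sdiff_insert_ef_of_subset_X hπX, card_sdiff_of_subset hπX, card_X hn he hf hef, hπ2] at hπcompl
  have hB5 : ((((gr N).erase e).erase f) \ π).card = 5 := by
    rw [card_sdiff_of_subset hπX, card_X hn he hf hef, hπ2]
  have hBrk : rk N ((((gr N).erase e).erase f) \ π) = 5 := by omega
  set X := ((gr N).erase e).erase f with hXdef
  set B₀ := X \ π with hB₀
  have hXg : X ⊆ gr N := X_subset_gr N e f
  have hBg : B₀ ⊆ gr N := sdiff_subset.trans hXg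
  have heB : e ∉ B₀ := fun h => (mem_erase.1 (mem_erase.1 (mem_sdiff.1 h).1).2).1 rfl
  have hsub : (tTwo N e f).filter (fun τ => π ⊆ τ) ⊆
      (B₀.filter (fun z => rk N (insert e (B₀.erase z)) ≤ 4)).image (fun z => insert z π) := by
    intro τ hτ
    rw [mem_filter] at hτ
    obtain ⟨hτT, hπτ⟩ := hτ
    have hrK := rk_insert_e_sdiff_of_tTwo hn he hf hef hτT
    have hτT' := hτT
    unfold tTwo at hτT'
    rw [mem_filter] at hτT'
    obtain ⟨hτD, _⟩ := hτT'
    obtain ⟨hτX, hτ3, _, _, _, _, _⟩ := edefect_facts hn he hf hef hτD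
    have hcard1 : (τ \ π).card = 1 := by rw [card_sdiff_of_subset hπτ, hτ3, hπ2]
    obtain ⟨z, hz⟩ := card_eq_one.1 hcard1
    have hzτπ : z ∈ τ \ π := by rw [hz]; exact mem_singleton_self z
    have hτeq : insert z π = τ := by
      ext a
      rw [mem_insert]
      constructor
      · rintro (rfl | ha)
        · exact (mem_sdiff.1 hzτπ).1
        · exact hπτ ha
      · intro ha
        by_cases haπ : a ∈ π
        · exact Or.inr haπ
        · left
          have : a ∈ τ \ π := mem_sdiff.2 ⟨ha, haπ⟩
          rw [hz, mem_singleton] at this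
          exact this
    have hzB : z ∈ B₀ := mem_sdiff.2 ⟨hτX (mem_sdiff.1 hzτπ).1, (mem_sdiff.1 hzτπ).2⟩
    have hKeq : X \ τ = B₀.erase z := by
      rw [← hτeq, hB₀]
      ext a
      simp only [mem_sdiff, mem_erase, mem_insert, not_or]
      tauto
    rw [mem_image]
    refine ⟨z, ?_, hτeq⟩
    rw [mem_filter]
    refine ⟨hzB, ?_⟩
    rw [← hKeq, hrK]
  calc ((tTwo N e f).filter (fun τ => π ⊆ τ)).card
      ≤ ((B₀.filter (fun z => rk N (insert e (B₀.erase z)) ≤ 4)).image (fun z => insert z π)).card :=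
        card_le_card hsub
    _ ≤ (B₀.filter (fun z => rk N (insert e (B₀.erase z)) ≤ 4)).card := card_image_le
    _ ≤ 2 := card_filter_mem_clF_erase_le_two_of_five he he3 hBg heB hB5 hBrk

/-- **THE FIRST-KIND BOUND WITHOUT KILLS AND WITHOUT `3`-CIRCUITS THROUGH `e`**: `#tTwo ≤ #cPairs`, by the double count
over `π ⊆ τ` (every first-kind defect has `≥ 2` `C`-pairs inside it, every `C`-pair lies in `≤ 2`). -/
theorem card_tTwo_le_card_cPairs_of_noKill (hn : (gr N).card = 9)
    (hcos : ∀ x ∈ gr N, ∀ y ∈ gr N, x ≠ y → rk N (((gr N).erase x).erase y) = 5) {e f : α} (he : e ∈ gr N)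
    (hf : f ∈ gr N) (hef : e ≠ f) (he3 : ∀ A ⊆ gr N, e ∉ A → A.card = 2 → e ∉ clF N A)
    (hnk : ∀ A ⊆ ((gr N).erase e).erase f, A.card = 2 → rk N (insert e A) = 3 → f ∉ clF N (insert e A)) :
    (tTwo N e f).card ≤ (cPairs N e f).card := by
  have hdc := sum_card_bipartiteAbove_eq_sum_card_bipartiteBelow (fun (τ π : Finset α) => π ⊆ τ)
    (s := tTwo N e f) (t := cPairs N e f)
  have hlow : (tTwo N e f).card • 2 ≤
      ∑ τ ∈ tTwo N e f, (bipartiteAbove (fun τ π => π ⊆ τ) (cPairs N e f) τ).card := by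
    apply card_nsmul_le_sum
    intro τ hτ
    unfold bipartiteAbove
    exact two_le_card_cPairs_subset_of_noKill hn hcos he hf hef hnk hτ
  have hup : ∑ π ∈ cPairs N e f, (bipartiteBelow (fun τ π => π ⊆ τ) (tTwo N e f) π).card ≤
      (cPairs N e f).card • 2 := by
    apply sum_le_card_nsmul
    intro π hπ
    unfold bipartiteBelow
    exact card_tTwo_supset_le_two_of_three_circuit_free hn he hf hef he3 hπ
  rw [hdc] at hlow
  have := hlow.trans hup
  simp only [smul_eq_mul] at this
  omega

/-- **(★)₉ WITHOUT KILLS AND WITHOUT `3`-CIRCUITS THROUGH `e`**: on a simple cosimple `N` with `#E = 9`,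
`in_4(e) ≤ in_4(f) + thru_4({e, f})` whenever `e` lies on no `3`-circuit and `f ∉ cl(A + e)` for every independent
`A + e` with `A ⊆ E − e − f` a pair. -/
theorem inCount_le_of_noKill (hn : (gr N).card = 9)
    (hsimple : ∀ x ∈ gr N, ∀ y ∈ gr N, x ≠ y → rk N {x, y} = 2)
    (hcos : ∀ x ∈ gr N, ∀ y ∈ gr N, x ≠ y → rk N (((gr N).erase x).erase y) = 5) {e f : α} (he : e ∈ gr N)
    (hf : f ∈ gr N) (hef : e ≠ f) (he3 : ∀ A ⊆ gr N, e ∉ A → A.card = 2 → e ∉ clF N A)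
    (hnk : ∀ A ⊆ ((gr N).erase e).erase f, A.card = 2 → rk N (insert e A) = 3 → f ∉ clF N (insert e A)) :
    inCount N 4 e ≤ inCount N 4 f + thruCount N 4 {e, f} := by
  apply starNine_of_defect_bound hef
  apply defect_bound_of_tTwo_bound hn hsimple hcos he hf hef
  have := card_tTwo_le_card_cPairs_of_noKill hn hcos he hf hef he3 hnk
  omega

end StarNineSplitD

end PercRepro.Cogirth
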